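import Literature.Computability.Cryptography.GapSVPToSISErrorBudget
import Literature.Algebra.EuclideanLattices.LatticeComplexity
import HarnessLib

/-!
# MR07 Thm. 5.23: the polynomial parameter choice makes the NO-case error of the idealised reduction eventually small — proved

Topic `Computability/Cryptography` (family `pqc`). Theorems only (real analysis). The idealised
reduction of Micciancio–Regev 2007, Thm. 5.23 (`MRGapCVPIdealised.toReal_reduction_false_le`) errs on
NO instances with probability at most
`(T+1)(1−p)^{k₀} + N(1 − (δ′ − mε′))^k + e^{−N(1/2−2ε)²/2} + e^{−N/K⁴}(4√nK²)ⁿ + N·m(1+ε)/(1−ε)ε`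
(`ε = 2⁻ⁿ`, `ε′ = 2ε/(1+ε)`, `K = √(nm)`, `p = (δ/(2βm) − mε′)/3`, `δ ≥ δ′ ≥ 1/n^c` the oracle's
SIS/SIS′ success). This file fixes the remaining parameters polynomially in `n` —
`N = n⁴m³` (the repaired sample count of `GapSVPToSISErrorBudget`), `k = n^{c+1}` runs per block,
`k₀ = 24⌈β⌉ m n^{c+1}` solver runs per round — and proves that for every `η > 0` the total is
`≤ η` for all sufficiently large `n`, uniformly in `δ′ ∈ [1/n^c, 1]` and in loop lengths
`T + 1 ≤ 2ⁿ` (MR07 p. 29: "errs with probability `2^{−Ω(n)}` … for all sufficiently large `n`";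
the loop of Lemma 5.10 makes polynomially many rounds in the input size, and inputs of size `≥ 2ⁿ`
are handled exactly by any polynomial-time machine).

* `MicciancioRegev2007.isPolyBounded_ceil_mul_sq` — `8⌈β⌉m²` is polynomially bounded;
* `MicciancioRegev2007.pow_le_exp_neg_of_le` — `(1 − p)^k ≤ e^{−x}` when `x/k ≤ p ≤ 1`;
* `MicciancioRegev2007.eventually_total_error_le` — the statement above.

## References

* D. Micciancio, O. Regev, *Worst-case to average-case reductions based on Gaussian measures*,
  SIAM J. Comput. 37 (2007) 267–302; authors' version, Thm. 5.23 and its proof, pp. 28–31, with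
  Cor. 5.13 / Lemma 5.10 (number of oracle calls polynomial in the input size).
-/

noncomputable section

open Filter Topology Literature.Algebra.EuclideanLattices

namespace Literature.Computability.Cryptography

namespace MicciancioRegev2007

open LWE LWE.RegevReduction

/-- `8⌈β(n)⌉ m(n)²` is polynomially bounded for polynomially bounded `β ≥ 0` and `m`. [folklore] -/
theorem isPolyBounded_ceil_mul_sq {m : ℕ → ℕ} (hm : IsPolyBounded m) {β : ℕ → ℝ}
    (hβ : IsPolyBoundedReal β) : IsPolyBounded fun n => 8 * ⌈β n⌉₊ * m n ^ 2 := by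
  obtain ⟨p, hp⟩ := hm
  obtain ⟨r, hr⟩ := hβ
  refine ⟨8 * r * p ^ 2, fun n => ?_⟩
  rw [Polynomial.eval_mul, Polynomial.eval_mul, Polynomial.eval_pow]
  have hceil : ⌈β n⌉₊ ≤ r.eval n := Nat.ceil_le.2 (hr n)
  have h8 : (8 : Polynomial ℕ).eval n = 8 := by simp
  rw [h8]
  exact Nat.mul_le_mul (Nat.mul_le_mul_left 8 hceil) (Nat.pow_le_pow_left (hp n) 2)

/-- **`(1 − p)^k ≤ e^{−x}` when `x ≤ pk` and `p ≤ 1`** (`1 − p ≤ e^{−p}`). [folklore] -/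
theorem pow_le_exp_neg_of_le {p x : ℝ} {k : ℕ} (hp1 : p ≤ 1) (hx : x ≤ p * k) :
    (1 - p) ^ k ≤ Real.exp (-x) := by
  have h1 : 1 - p ≤ Real.exp (-p) := by
    have := Real.add_one_le_exp (-p)
    linarith
  calc (1 - p) ^ k ≤ Real.exp (-p) ^ k := pow_le_pow_left₀ (by linarith) h1 k
    _ = Real.exp (-(p * k)) := by rw [← Real.exp_nat_mul]; ring_nf
    _ ≤ Real.exp (-x) := Real.exp_le_exp.2 (by linarith)

set_option maxHeartbeats 400000 in
/-- **The polynomial parameter choice of MR07 Thm. 5.23 makes the NO-case error eventually `≤ η`**: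
for polynomially bounded `m ≥ 1`, `β ≥ 1` and every `c`, `η > 0`, eventually in `n`, for all
`1/n^c ≤ δ′ ≤ δ ≤ 1` and all `T` with `T + 1 ≤ 2ⁿ`, with `ε = 2⁻ⁿ`, `N = n⁴m³`, `K = √(nm)`,
`k = n^{c+1}`, `k₀ = 24⌈β⌉mn^{c+1}`:
`(T+1)(1 − (δ/(2βm) − mε′)/3)^{k₀} + N(1 − (δ′ − mε′))^k + e^{−N(1/2−2ε)²/2} + e^{−N/K⁴}(4√nK²)ⁿ +
N·m(1+ε)/(1−ε)ε ≤ η`. [cite: MicciancioRegev2007, Thm. 5.23 (proof, NO case, pp. 29–31)] -/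
theorem eventually_total_error_le {m : ℕ → ℕ} (hm : IsPolyBounded m) (hm1 : ∀ n, 1 ≤ m n)
    {β : ℕ → ℝ} (hβ : IsPolyBoundedReal β) (hβ1 : ∀ n, 1 ≤ β n) (c : ℕ) {η : ℝ} (hη : 0 < η) :
    ∀ᶠ n : ℕ in atTop, ∀ (δ' δ : ℝ), 1 / (n : ℝ) ^ c ≤ δ' → δ' ≤ δ → δ ≤ 1 →
      ∀ T : ℕ, (T + 1 : ℝ) ≤ 2 ^ n →
        (T + 1 : ℝ) * (1 - (1 / 3 : ℝ) * (δ / (2 * β n * m n) -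
            m n * (2 * (2⁻¹ : ℝ) ^ n / (1 + (2⁻¹ : ℝ) ^ n)))) ^ (24 * ⌈β n⌉₊ * m n * n ^ (c + 1)) +
          (((n ^ 4 * m n ^ 3 : ℕ) : ℝ) *
              (1 - (δ' - m n * (2 * (2⁻¹ : ℝ) ^ n / (1 + (2⁻¹ : ℝ) ^ n)))) ^ (n ^ (c + 1)) +
            (Real.exp (-(((n ^ 4 * m n ^ 3 : ℕ) : ℝ) * (1 / 2 - 2 * (2⁻¹ : ℝ) ^ n) ^ 2 / 2)) +
              (Real.exp (-(((n ^ 4 * m n ^ 3 : ℕ) : ℝ) / Real.sqrt ((n : ℝ) * m n) ^ 4)) *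
                  (4 * Real.sqrt n * Real.sqrt ((n : ℝ) * m n) ^ 2) ^ n +
                ((n ^ 4 * m n ^ 3 : ℕ) : ℝ) *
                  (m n * ((1 + (2⁻¹ : ℝ) ^ n) / (1 - (2⁻¹ : ℝ) ^ n) * (2⁻¹ : ℝ) ^ n))))) ≤ η := by
  have hbud := eventually_noCase_error_le hm hm1 (half_pos hη)
  have hεm := eventually_two_inv_pow_mul_lt_inv_pow (isPolyBounded_ceil_mul_sq hm hβ) c
  have hexp : ∀ᶠ n : ℕ in atTop, Real.exp (-(n : ℝ)) ≤ η / 2 := by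
    have ht : Tendsto (fun n : ℕ => Real.exp (-(n : ℝ))) atTop (𝓝 0) :=
      Real.tendsto_exp_atBot.comp (tendsto_neg_atTop_atBot.comp tendsto_natCast_atTop_atTop)
    exact ht.eventually (ge_mem_nhds (by positivity))
  filter_upwards [hbud, hεm, hexp, eventually_ge_atTop 1] with n hbudn hεmn hexpn hn1
  intro δ' δ hδ' hδ'δ hδ1 T hT
  -- shorthands and positivity
  set ε : ℝ := (2⁻¹ : ℝ) ^ n with hε
  set ε' : ℝ := 2 * ε / (1 + ε) with hε'
  have hnR : (1 : ℝ) ≤ n := by exact_mod_cast hn1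
  have hn0 : (0 : ℝ) < n := by linarith
  have hmR : (1 : ℝ) ≤ m n := by exact_mod_cast hm1 n
  have hβR : 1 ≤ β n := hβ1 n
  have hε0 : 0 < ε := by rw [hε]; positivity
  have hε1 : ε ≤ 1 := by rw [hε]; exact pow_le_one₀ (by norm_num) (by norm_num)
  have hε'0 : 0 ≤ ε' := by rw [hε']; positivity
  have hε'le : ε' ≤ 2 * ε := by
    rw [hε', div_le_iff₀ (by linarith)]
    nlinarith
  have hnc : 0 < (n : ℝ) ^ c := by positivity
  have hδ'pos : 0 < δ' := lt_of_lt_of_le (by positivity) hδ'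
  have hδ'1 : δ' ≤ 1 := hδ'δ.trans hδ1
  -- `m ε′ · 4βm ≤ 8⌈β⌉m²ε < 1/n^c ≤ δ′`
  have hceil : β n ≤ ⌈β n⌉₊ := Nat.le_ceil _
  have hceil1 : (1 : ℝ) ≤ ⌈β n⌉₊ := hβR.trans hceil
  have hkey : m n * ε' * (4 * β n * m n) ≤ δ' := by
    have h1 : (2⁻¹ : ℝ) ^ n * ((8 * ⌈β n⌉₊ * m n ^ 2 : ℕ) : ℝ) < 1 / (n : ℝ) ^ c := hεmn
    have h2 : m n * ε' * (4 * β n * m n) ≤ (2⁻¹ : ℝ) ^ n * ((8 * ⌈β n⌉₊ * m n ^ 2 : ℕ) : ℝ) := by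
      rw [← hε]
      push_cast
      have : m n * ε' * (4 * β n * m n) ≤ m n * (2 * ε) * (4 * ⌈β n⌉₊ * m n) := by
        gcongr
      nlinarith
    linarith
  have hβm : 1 ≤ β n * m n := one_le_mul_of_one_le_of_one_le hβR hmR
  have hmε'0 : 0 ≤ (m n : ℝ) * ε' := by positivity
  have hmε'half : m n * ε' ≤ δ' / 2 := by
    have h : 4 * (m n * ε') ≤ m n * ε' * (4 * β n * m n) := by nlinarith
    linarith
  have hmε'q : m n * ε' ≤ δ' / (4 * β n * m n) := by
    rw [le_div_iff₀ (by positivity)]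
    exact hkey
  -- (A) the loop term: `p ≥ δ′/(12βm)`, `(1 − p)^{k₀} ≤ e^{−2n}`, `(T+1)(1−p)^{k₀} ≤ e^{−n}`
  set p : ℝ := (1 / 3 : ℝ) * (δ / (2 * β n * m n) - m n * ε') with hp
  have hp1 : p ≤ 1 := by
    rw [hp]
    have h1 : δ / (2 * β n * m n) ≤ 1 / 2 := by
      rw [div_le_iff₀ (by positivity)]
      nlinarith
    have h2 : 0 ≤ m n * ε' := by positivity
    linarith
  have hplow : δ' / (12 * β n * m n) ≤ p := by
    rw [hp]
    have h1 : δ' / (2 * β n * m n) ≤ δ / (2 * β n * m n) :=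
      div_le_div_of_nonneg_right hδ'δ (by positivity)
    have h2 : δ' / (12 * β n * m n) = (1 / 3 : ℝ) * (δ' / (2 * β n * m n) - δ' / (4 * β n * m n)) := by
      field_simp
      ring
    rw [h2]
    exact mul_le_mul_of_nonneg_left (by linarith) (by norm_num)
  have hA1 : (1 - p) ^ (24 * ⌈β n⌉₊ * m n * n ^ (c + 1)) ≤ Real.exp (-(2 * n)) := by
    refine pow_le_exp_neg_of_le hp1 ?_
    have hk : ((24 * ⌈β n⌉₊ * m n * n ^ (c + 1) : ℕ) : ℝ) = 24 * ⌈β n⌉₊ * m n * ((n : ℝ) ^ c * n) := by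
      push_cast; ring
    rw [hk]
    have h1 : δ' / (12 * β n * m n) * (24 * ⌈β n⌉₊ * m n * ((n : ℝ) ^ c * n)) ≤
        p * (24 * ⌈β n⌉₊ * m n * ((n : ℝ) ^ c * n)) :=
      mul_le_mul_of_nonneg_right hplow (by positivity)
    refine le_trans ?_ h1
    -- `2n ≤ δ′ n^c · (⌈β⌉/β) · 2n`
    have hδn : 1 ≤ δ' * (n : ℝ) ^ c := by
      rw [div_le_iff₀ hnc] at hδ'
      linarith
    have hrew : δ' / (12 * β n * m n) * (24 * ⌈β n⌉₊ * m n * ((n : ℝ) ^ c * n)) =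
        (δ' * (n : ℝ) ^ c) * (⌈β n⌉₊ / β n) * (2 * n) := by
      field_simp
      ring
    rw [hrew]
    have hcb : 1 ≤ (⌈β n⌉₊ : ℝ) / β n := by
      rw [le_div_iff₀ (by linarith)]
      linarith
    calc (2 * (n : ℝ)) = 1 * 1 * (2 * n) := by ring
      _ ≤ (δ' * (n : ℝ) ^ c) * (⌈β n⌉₊ / β n) * (2 * n) := by
          gcongr
  have hA : (T + 1 : ℝ) * (1 - p) ^ (24 * ⌈β n⌉₊ * m n * n ^ (c + 1)) ≤ Real.exp (-(n : ℝ)) := by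
    have h2e : (2 : ℝ) ^ n ≤ Real.exp n := by
      have h2 : (2 : ℝ) ≤ Real.exp 1 := by
        have := Real.add_one_le_exp (1 : ℝ)
        linarith
      calc (2 : ℝ) ^ n ≤ Real.exp 1 ^ n := pow_le_pow_left₀ (by norm_num) h2 n
        _ = Real.exp n := by rw [← Real.exp_nat_mul, mul_one]
    have hpk : 0 ≤ (1 - p) ^ (24 * ⌈β n⌉₊ * m n * n ^ (c + 1)) := pow_nonneg (by linarith) _
    calc (T + 1 : ℝ) * (1 - p) ^ (24 * ⌈β n⌉₊ * m n * n ^ (c + 1))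
        ≤ Real.exp n * Real.exp (-(2 * n)) :=
          mul_le_mul (hT.trans h2e) hA1 hpk (Real.exp_pos _).le
      _ = Real.exp (-(n : ℝ)) := by rw [← Real.exp_add]; ring_nf
  -- (B) the block term: `N(1 − (δ′ − mε′))^{n^{c+1}} ≤ N e^{−n/2}`
  have hB1 : (1 - (δ' - m n * ε')) ^ (n ^ (c + 1)) ≤ Real.exp (-((n : ℝ) / 2)) := by
    have h := pow_le_exp_neg_of_le (p := δ' - m n * ε') (x := (n : ℝ) / 2) (k := n ^ (c + 1))
      (by linarith [hmε'0, hδ'1]) ?_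
    · exact h
    · have hk : ((n ^ (c + 1) : ℕ) : ℝ) = (n : ℝ) ^ c * n := by push_cast; ring
      rw [hk]
      have hδn : 1 ≤ δ' * (n : ℝ) ^ c := by
        rw [div_le_iff₀ hnc] at hδ'
        linarith
      have h1 : δ' / 2 ≤ δ' - m n * ε' := by linarith
      calc (n : ℝ) / 2 = 1 * n / 2 := by ring
        _ ≤ δ' * (n : ℝ) ^ c * n / 2 := by gcongr
        _ = δ' / 2 * ((n : ℝ) ^ c * n) := by ring
        _ ≤ (δ' - m n * ε') * ((n : ℝ) ^ c * n) :=
            mul_le_mul_of_nonneg_right h1 (by positivity)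
  have hNdef : (((n ^ 4 * m n ^ 3 : ℕ)) : ℝ) = (n : ℝ) ^ 4 * (m n : ℝ) ^ 3 := by push_cast; ring
  have hB : ((n : ℝ) ^ 4 * (m n : ℝ) ^ 3) * (1 - (δ' - m n * ε')) ^ (n ^ (c + 1)) ≤
      ((n : ℝ) ^ 4 * (m n : ℝ) ^ 3) * Real.exp (-((n : ℝ) / 2)) :=
    mul_le_mul_of_nonneg_left hB1 (by positivity)
  -- assemble with the error budget
  rw [hNdef]
  have hsum := add_le_add hA (add_le_add hB (le_refl
    (Real.exp (-((n : ℝ) ^ 4 * (m n : ℝ) ^ 3 * (1 / 2 - 2 * ε) ^ 2 / 2)) +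
      (Real.exp (-((n : ℝ) ^ 4 * (m n : ℝ) ^ 3 / Real.sqrt ((n : ℝ) * m n) ^ 4)) *
          (4 * Real.sqrt n * Real.sqrt ((n : ℝ) * m n) ^ 2) ^ n +
        (n : ℝ) ^ 4 * (m n : ℝ) ^ 3 * (m n * ((1 + ε) / (1 - ε) * ε))))))
  linarith

end MicciancioRegev2007

end Literature.Computability.Cryptography

end
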